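import Mathlib

/-!
# T5TameCongruence — the tame-ramification congruence in prime-degree Galois extensions of `ℚ`

Seat p3 of the blind cell `pub-hodge-repro2` (Tier-5 support column for sub-step N2 of
`route/TIER5.md`).  A kernel witness behind the sentence of §N2.8.2(b) of `route/T5-N2-route-3.md`,
«2 NEVER RAMIFIES in F⁺ (… conductor–discriminant; Kronecker–Weber)».  The earlier witness
`T5CubicRamification` carries that sentence only for cubic subfields of cyclotomic fields, i.e.
modulo the Kronecker–Weber theorem, which this Mathlib does not contain.  Here the dependency is
removed: for a number field `F`, Galois over `ℚ` of PRIME degree `ℓ`, and a rational prime `p`, a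
prime `P` of `𝓞 F` above `p` with ramification index `e(P ∣ p) = ℓ` forces `p = ℓ` or
`p ≡ 1 (mod ℓ)` — the classical tame-ramification congruence `e ∣ p^f − 1` (Serre, *Local Fields*,
Ch. IV §2, Cor. 1 to Prop. 7, with `f = 1`).  Since neither inertia groups with their tame/wild
filtration nor Kronecker–Weber are available in the kernel, the proof is an elementary re-derivation:

* the fundamental identity `g · e · f = ℓ` gives `g = f = 1`, so `P` is the unique prime above `p`
  (hence Galois-stable) and every element of `𝓞 F` is congruent to a rational integer modulo `P`;
* for a uniformiser `π ∈ P ∖ P²` and `σ ∈ Gal(F/ℚ)` one has `σ π ≡ a_σ · π (mod P²)` with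
  `a_σ ∈ ℤ`, and `σ ↦ a_σ mod p` is multiplicative with values in `(ℤ/p)^×`; so
  `a_σ^ℓ ≡ a_σ^{p−1} ≡ 1 (mod p)`, and `gcd(ℓ, p − 1) = 1` gives `σ π ≡ π (mod P²)` for every `σ`;
* the trace `Tr(π) = Σ_σ σ π ≡ ℓ · π (mod P²)` is a rational integer lying in `P`, hence in
  `p ℤ ⊆ P^ℓ ⊆ P²`; so `ℓ · π ∈ P²` with `π ∉ P²`, i.e. `ℓ ∈ P`, i.e. `p = ℓ`.

Consequences recorded here: in every Galois (= cyclic) cubic number field the prime `2` is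
unramified, and a ramified rational prime is `3` or `≡ 1 (mod 3)` — the statements of
`T5CubicRamification.ramificationIdx_two_eq_one` / `eq_three_or_mod_three_eq_one_of_ramified`
without their cyclotomic hypothesis.

Declaration of README §8(d): this file uses an L-value-free non-vanishing device: NO.
-/

namespace Summit.Ventures.HodgeRepro2.T5TameCongruence

open NumberField Ideal
open scoped Pointwise

variable {F : Type*} [Field F] [NumberField F]

section galoisAction

variable [IsGalois ℚ F]

/-- The Galois group `Gal(F/ℚ)` of a Galois number field acts on `𝓞 F` as a Galois group
over `ℤ` (Mathlib's `IsGaloisGroup`), through the restriction of automorphisms to integers. -/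
theorem isGaloisGroup_gal : IsGaloisGroup Gal(F/ℚ) ℤ (𝓞 F) :=
  IsGaloisGroup.of_isFractionRing Gal(F/ℚ) ℤ (𝓞 F) ℚ F

omit [IsGalois ℚ F] in
/-- A Galois automorphism fixes the image of every rational integer in `𝓞 F`. -/
theorem smul_algebraMap_int (σ : Gal(F/ℚ)) (a : ℤ) :
    σ • algebraMap ℤ (𝓞 F) a = algebraMap ℤ (𝓞 F) a := by
  rw [algebraMap_int_eq, Int.coe_castRingHom]
  exact map_intCast (MulSemiringAction.toRingHom Gal(F/ℚ) (𝓞 F) σ) a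

/-- The sum of the Galois conjugates of an algebraic integer `x` is the (integral) trace of `x`,
viewed in `𝓞 F`. -/
theorem sum_smul_eq_intTrace (x : 𝓞 F) :
    (∑ σ : Gal(F/ℚ), σ • x) = algebraMap ℤ (𝓞 F) (Algebra.intTrace ℤ (𝓞 F) x) := by
  apply IsIntegralClosure.algebraMap_injective (𝓞 F) ℤ F
  rw [← IsScalarTower.algebraMap_apply, IsScalarTower.algebraMap_eq ℤ ℚ F]
  simp only [map_sum, RingHom.coe_comp, Function.comp_apply,
    Algebra.algebraMap_intTrace (K := ℚ) (L := F)]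
  rw [trace_eq_sum_automorphisms]
  rfl

/-- The fundamental identity `g · (e · f) = [F : ℚ]` for a rational prime `p`, in the Galois case:
the number of primes of `𝓞 F` above `p`, times the common ramification index, times the common
inertia degree, is the degree. -/
theorem ncard_primesOver_mul_ramificationIdx_mul_inertiaDeg {p : ℕ} (hp : p.Prime)
    (P : Ideal (𝓞 F)) [P.IsPrime] [P.LiesOver (span {(p : ℤ)})] :
    ((span {(p : ℤ)}).primesOver (𝓞 F)).ncard * (P.ramificationIdx ℤ * P.inertiaDeg ℤ) =
      Module.finrank ℚ F := by
  haveI := isGaloisGroup_gal (F := F)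
  haveI : (span {(p : ℤ)}).IsPrime :=
    (span_singleton_prime (by exact_mod_cast hp.ne_zero)).mpr (Nat.prime_iff_prime_int.mp hp)
  rw [← ramificationIdxIn_eq_ramificationIdx (span {(p : ℤ)}) P Gal(F/ℚ),
    ← inertiaDegIn_eq_inertiaDeg (span {(p : ℤ)}) P Gal(F/ℚ),
    ncard_primesOver_mul_ramificationIdxIn_mul_inertiaDegIn (span {(p : ℤ)}) (𝓞 F) Gal(F/ℚ),
    IsGalois.card_aut_eq_finrank]

end galoisAction

section residue

omit [NumberField F] in
/-- A rational integer `n` lies in a prime `P` above `p` exactly when `p ∣ n`. -/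
theorem algebraMap_mem_iff_dvd {p : ℕ} (P : Ideal (𝓞 F)) [P.LiesOver (span {(p : ℤ)})] (n : ℤ) :
    algebraMap ℤ (𝓞 F) n ∈ P ↔ (p : ℤ) ∣ n := by
  rw [← mem_comap, ← under_def, ← P.over_def (span {(p : ℤ)}), mem_span_singleton]

/-- If the inertia degree of `P` over `ℤ` is `1`, every element of `𝓞 F` is congruent modulo `P`
to (the image of) a rational integer. -/
theorem exists_int_sub_mem_of_inertiaDeg_eq_one {p : ℕ} (hp : p.Prime) (P : Ideal (𝓞 F))
    [P.IsPrime] [P.LiesOver (span {(p : ℤ)})] (hf : P.inertiaDeg ℤ = 1) (x : 𝓞 F) :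
    ∃ a : ℤ, x - algebraMap ℤ (𝓞 F) a ∈ P := by
  have hp0 : (p : ℤ) ≠ 0 := by exact_mod_cast hp.ne_zero
  haveI hpI : (span {(p : ℤ)}).IsPrime :=
    (span_singleton_prime hp0).mpr (Nat.prime_iff_prime_int.mp hp)
  have hspan_bot : (span {(p : ℤ)}) ≠ ⊥ := by
    rw [Ne, span_singleton_eq_bot]; exact hp0
  haveI : (span {(p : ℤ)}).IsMaximal := hpI.isMaximal hspan_bot
  have hPbot : P ≠ ⊥ := ne_bot_of_liesOver_of_ne_bot hspan_bot P
  haveI : P.IsMaximal := Ideal.IsPrime.isMaximal inferInstance hPbot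
  have hf' : Module.finrank (ℤ ⧸ span {(p : ℤ)}) (𝓞 F ⧸ P) = 1 := by
    rw [← inertiaDeg'_algebraMap, inertiaDeg'_eq_inertiaDeg, hf]
  letI : Field (ℤ ⧸ span {(p : ℤ)}) := Ideal.Quotient.field _
  obtain ⟨c, hc⟩ := (finrank_eq_one_iff_of_nonzero' (1 : 𝓞 F ⧸ P) one_ne_zero).mp hf'
    (Ideal.Quotient.mk P x)
  obtain ⟨a, rfl⟩ := Ideal.Quotient.mk_surjective c
  refine ⟨a, ?_⟩
  rw [← Ideal.Quotient.eq, ← hc, Algebra.smul_def, mul_one,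
    Ideal.Quotient.algebraMap_mk_of_liesOver]

end residue

section main

variable [IsGalois ℚ F]

/-- **Tame-ramification congruence, prime degree.**  Let `F/ℚ` be Galois of prime degree `ℓ`, let
`p` be a rational prime and `P` a prime of `𝓞 F` above `p` with ramification index `e(P ∣ p) = ℓ`
(total ramification).  Then `p = ℓ` or `p ≡ 1 (mod ℓ)`. -/
theorem eq_or_mod_eq_one_of_ramificationIdx_eq_finrank
    (hℓ : (Module.finrank ℚ F).Prime) {p : ℕ} (hp : p.Prime)
    (P : Ideal (𝓞 F)) [hP : P.IsPrime] [hPp : P.LiesOver (span {(p : ℤ)})]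
    (he : P.ramificationIdx ℤ = Module.finrank ℚ F) :
    p = Module.finrank ℚ F ∨ p % Module.finrank ℚ F = 1 := by
  classical
  by_contra hcon
  push Not at hcon
  haveI := isGaloisGroup_gal (F := F)
  set ℓ := Module.finrank ℚ F with hℓdef
  have hℓ2 : 2 ≤ ℓ := hℓ.two_le
  have hp0 : (p : ℤ) ≠ 0 := by exact_mod_cast hp.ne_zero
  have hpZ : Prime (p : ℤ) := Nat.prime_iff_prime_int.mp hp
  haveI hpI : (span {(p : ℤ)}).IsPrime := (span_singleton_prime hp0).mpr hpZ
  have hspan_bot : (span {(p : ℤ)}) ≠ ⊥ := by simpa using hp0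
  haveI hpM : (span {(p : ℤ)}).IsMaximal := hpI.isMaximal hspan_bot
  have hPbot : P ≠ ⊥ := ne_bot_of_liesOver_of_ne_bot hspan_bot P
  haveI hPM : P.IsMaximal := hP.isMaximal hPbot
  have hPtop : P ≠ ⊤ := hPM.ne_top
  -- the fundamental identity forces `g = 1` and `f = 1`
  have hfund := ncard_primesOver_mul_ramificationIdx_mul_inertiaDeg hp P
  rw [he, ← hℓdef] at hfund
  have hgf : ((span {(p : ℤ)}).primesOver (𝓞 F)).ncard * P.inertiaDeg ℤ = 1 := by
    have h1 : ℓ * (((span {(p : ℤ)}).primesOver (𝓞 F)).ncard * P.inertiaDeg ℤ) = ℓ * 1 := by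
      rw [mul_one]
      calc ℓ * (((span {(p : ℤ)}).primesOver (𝓞 F)).ncard * P.inertiaDeg ℤ)
          = ((span {(p : ℤ)}).primesOver (𝓞 F)).ncard * (ℓ * P.inertiaDeg ℤ) := by ring
        _ = ℓ := hfund
    exact Nat.eq_of_mul_eq_mul_left hℓ.pos h1
  have hg : ((span {(p : ℤ)}).primesOver (𝓞 F)).ncard = 1 := Nat.eq_one_of_mul_eq_one_right hgf
  have hf : P.inertiaDeg ℤ = 1 := Nat.eq_one_of_mul_eq_one_left hgf
  -- `p ∈ P ^ 2` (indeed `p 𝓞 F = P ^ ℓ` and `ℓ ≥ 2`)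
  have hpP2 : algebraMap ℤ (𝓞 F) (p : ℤ) ∈ P ^ 2 := by
    have h1 : map (algebraMap ℤ (𝓞 F)) (span {(p : ℤ)}) ≤ P ^ ℓ := by
      have := le_pow_ramificationIdx' (R := ℤ) (S := 𝓞 F) (p := span {(p : ℤ)}) (P := P)
      rwa [ramificationIdx'_eq_ramificationIdx _ _ hspan_bot, he] at this
    have h2 : P ^ ℓ ≤ P ^ 2 := Ideal.pow_le_pow_right hℓ2
    exact h2 (h1 (mem_map_of_mem _ (mem_span_singleton_self _)))
  -- integers in `P`, and integers in `P ^ 2`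
  have hint : ∀ n : ℤ, algebraMap ℤ (𝓞 F) n ∈ P ↔ (p : ℤ) ∣ n := algebraMap_mem_iff_dvd P
  have hint2 : ∀ n : ℤ, (p : ℤ) ∣ n → algebraMap ℤ (𝓞 F) n ∈ P ^ 2 := by
    rintro n ⟨k, rfl⟩
    rw [map_mul]
    exact Ideal.mul_mem_right _ _ hpP2
  -- residue field `𝔽_p`: every element is congruent to an integer mod `P`
  have hres := exists_int_sub_mem_of_inertiaDeg_eq_one hp P hf
  -- `P` is the unique prime above `p`, hence Galois-stable
  have hstab : ∀ σ : Gal(F/ℚ), σ • P = P := by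
    intro σ
    obtain ⟨Q, hQ⟩ := Set.ncard_eq_one.mp hg
    have h1 : P ∈ (span {(p : ℤ)}).primesOver (𝓞 F) := ⟨hP, hPp⟩
    have h2 : σ • P ∈ (span {(p : ℤ)}).primesOver (𝓞 F) :=
      (primesOver.mk (span {(p : ℤ)}) (σ • P)).2
    rw [hQ, Set.mem_singleton_iff] at h1 h2
    rw [h2, h1]
  have hstab2 : ∀ σ : Gal(F/ℚ), σ • (P ^ 2) = P ^ 2 := fun σ => by
    rw [smul_pow', hstab]
  have hsmul_mem : ∀ (σ : Gal(F/ℚ)) (x : 𝓞 F), x ∈ P → σ • x ∈ P := fun σ x hx => by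
    rw [← hstab σ]; exact smul_mem_pointwise_smul σ x P hx
  have hsmul_mem2 : ∀ (σ : Gal(F/ℚ)) (x : 𝓞 F), x ∈ P ^ 2 → σ • x ∈ P ^ 2 := fun σ x hx => by
    rw [← hstab2 σ]; exact smul_mem_pointwise_smul σ x (P ^ 2) hx
  have hsmul_notMem2 : ∀ (σ : Gal(F/ℚ)) (x : 𝓞 F), x ∉ P ^ 2 → σ • x ∉ P ^ 2 := fun σ x hx h => by
    rw [← hstab2 σ, smul_mem_pointwise_smul_iff] at h; exact hx h
  -- a uniformiser `π ∈ P ∖ P ^ 2`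
  obtain ⟨π, hπ1, hπ2⟩ := P.exists_mem_pow_notMem_pow_succ hPbot hPtop 1
  rw [pow_one] at hπ1
  -- `σ π ≡ a_σ π (mod P ^ 2)` with `a_σ ∈ ℤ`
  have hcoc : ∀ σ : Gal(F/ℚ), ∃ a : ℤ, σ • π - algebraMap ℤ (𝓞 F) a * π ∈ P ^ 2 := by
    intro σ
    obtain ⟨d, e, he2, hde⟩ := exists_mul_add_mem_pow_succ hPbot (i := 1) π (σ • π)
      (by simpa using hπ1) hπ2 (by simpa using hsmul_mem σ π hπ1)
    obtain ⟨a, ha⟩ := hres d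
    refine ⟨a, ?_⟩
    have : σ • π - algebraMap ℤ (𝓞 F) a * π = π * (d - algebraMap ℤ (𝓞 F) a) + e := by
      rw [← hde]; ring
    rw [this, pow_two]
    exact Ideal.add_mem _ (Ideal.mul_mem_mul hπ1 ha) (by simpa [pow_two] using he2)
  choose a ha using hcoc
  -- uniqueness of `a_σ` modulo `p`
  have huniq : ∀ m n : ℤ, (algebraMap ℤ (𝓞 F) m - algebraMap ℤ (𝓞 F) n) * π ∈ P ^ 2 →
      (p : ℤ) ∣ m - n := by
    intro m n h
    rw [mul_comm] at h
    have := mem_prime_of_mul_mem_pow hPbot (i := 1) hπ2 (by simpa using h)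
    have h' : algebraMap ℤ (𝓞 F) (m - n) ∈ P := by rw [map_sub]; exact this
    exact (hint _).mp h'
  -- multiplicativity modulo `p`
  have hmul : ∀ σ τ : Gal(F/ℚ), (p : ℤ) ∣ a (σ * τ) - a σ * a τ := by
    intro σ τ
    apply huniq
    have h1 : (σ * τ) • π = σ • (τ • π) := mul_smul σ τ π
    have h2 : σ • (τ • π) - algebraMap ℤ (𝓞 F) (a σ * a τ) * π ∈ P ^ 2 := by
      have e1 := hsmul_mem2 σ _ (ha τ)
      rw [smul_sub, smul_mul', smul_algebraMap_int] at e1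
      have e2 : σ • (τ • π) - algebraMap ℤ (𝓞 F) (a σ * a τ) * π =
          (σ • (τ • π) - algebraMap ℤ (𝓞 F) (a τ) * σ • π) +
            algebraMap ℤ (𝓞 F) (a τ) * (σ • π - algebraMap ℤ (𝓞 F) (a σ) * π) := by
        rw [map_mul]; ring
      rw [e2]
      exact Ideal.add_mem _ e1 (Ideal.mul_mem_left _ _ (ha σ))
    have e3 : (algebraMap ℤ (𝓞 F) (a (σ * τ)) - algebraMap ℤ (𝓞 F) (a σ * a τ)) * π =
        ((σ * τ) • π - algebraMap ℤ (𝓞 F) (a σ * a τ) * π) -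
          ((σ * τ) • π - algebraMap ℤ (𝓞 F) (a (σ * τ)) * π) := by ring
    rw [e3, h1]
    exact Ideal.sub_mem _ h2 (by rw [← h1]; exact ha (σ * τ))
  -- `a_1 ≡ 1`
  have hone : (p : ℤ) ∣ a 1 - 1 := by
    apply huniq
    have e1 : (algebraMap ℤ (𝓞 F) (a 1) - algebraMap ℤ (𝓞 F) 1) * π =
        -((1 : Gal(F/ℚ)) • π - algebraMap ℤ (𝓞 F) (a 1) * π) := by
      rw [one_smul, map_one]; ring
    rw [e1]
    exact (P ^ 2).neg_mem (ha 1)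
  -- `a_σ ≢ 0`
  have hne : ∀ σ : Gal(F/ℚ), ¬ (p : ℤ) ∣ a σ := by
    intro σ hdvd
    apply hsmul_notMem2 σ π hπ2
    have : σ • π = (σ • π - algebraMap ℤ (𝓞 F) (a σ) * π) + algebraMap ℤ (𝓞 F) (a σ) * π := by
      ring
    rw [this, pow_two]
    exact Ideal.add_mem _ (by simpa [pow_two] using ha σ)
      (Ideal.mul_mem_mul ((hint _).mpr hdvd) hπ1)
  -- pass to `ZMod p`
  haveI : Fact p.Prime := ⟨hp⟩
  let c : Gal(F/ℚ) → ZMod p := fun σ => (a σ : ZMod p)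
  have hc_mul : ∀ σ τ, c (σ * τ) = c σ * c τ := by
    intro σ τ
    simp only [c, ← Int.cast_mul]
    exact (ZMod.intCast_eq_intCast_iff_dvd_sub _ _ _).mpr (dvd_sub_comm.mp (hmul σ τ))
  have hc_one : c 1 = 1 := by
    have := (ZMod.intCast_eq_intCast_iff_dvd_sub (a 1) 1 p).mpr (dvd_sub_comm.mp hone)
    simpa [c] using this
  have hc_pow : ∀ (σ : Gal(F/ℚ)) (n : ℕ), c (σ ^ n) = c σ ^ n := by
    intro σ n
    induction n with
    | zero => simp [hc_one]
    | succ n ih => rw [pow_succ, hc_mul, ih, pow_succ]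
  have hc_ne : ∀ σ, c σ ≠ 0 := by
    intro σ h
    exact hne σ ((ZMod.intCast_zmod_eq_zero_iff_dvd _ _).mp h)
  have hcard : Nat.card Gal(F/ℚ) = ℓ := IsGalois.card_aut_eq_finrank ℚ F
  have hpowℓ : ∀ σ, c σ ^ ℓ = 1 := by
    intro σ
    rw [← hc_pow, ← hcard, pow_card_eq_one', hc_one]
  have hpowp : ∀ σ, c σ ^ (p - 1) = 1 := fun σ => ZMod.pow_card_sub_one_eq_one (hc_ne σ)
  have hgcd : Nat.gcd ℓ (p - 1) = 1 := by
    apply Nat.Coprime.gcd_eq_one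
    rw [hℓ.coprime_iff_not_dvd]
    rintro ⟨k, hk⟩
    apply hcon.2
    have hp1 : p = ℓ * k + 1 := by have := hp.one_lt; omega
    rw [hp1, Nat.mul_add_mod, Nat.mod_eq_of_lt hℓ.one_lt]
  have hc_eq_one : ∀ σ, c σ = 1 := by
    intro σ
    have := (pow_gcd_eq_one (a := c σ) (m := ℓ) (n := p - 1)).mpr ⟨hpowℓ σ, hpowp σ⟩
    rwa [hgcd, pow_one] at this
  -- hence `σ π ≡ π (mod P ^ 2)` for every `σ`
  have hfix : ∀ σ : Gal(F/ℚ), σ • π - π ∈ P ^ 2 := by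
    intro σ
    have h1 : (p : ℤ) ∣ 1 - a σ := by
      have := (ZMod.intCast_eq_intCast_iff_dvd_sub (a σ) 1 p).mp (by simpa [c] using hc_eq_one σ)
      exact this
    have e1 : σ • π - π = (σ • π - algebraMap ℤ (𝓞 F) (a σ) * π) -
        (algebraMap ℤ (𝓞 F) (1 - a σ)) * π := by
      rw [map_sub, map_one]; ring
    rw [e1, pow_two]
    exact Ideal.sub_mem _ (by simpa [pow_two] using ha σ)
      (Ideal.mul_mem_mul ((hint _).mpr h1) hπ1)
  -- the trace of `π`
  have hcardF : Fintype.card Gal(F/ℚ) = ℓ := by rw [Fintype.card_eq_nat_card, hcard]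
  have htr : algebraMap ℤ (𝓞 F) (Algebra.intTrace ℤ (𝓞 F) π) - (ℓ : 𝓞 F) * π ∈ P ^ 2 := by
    have h1 : (∑ σ : Gal(F/ℚ), (σ • π - π)) ∈ P ^ 2 := Ideal.sum_mem _ fun σ _ => hfix σ
    rwa [Finset.sum_sub_distrib, sum_smul_eq_intTrace, Finset.sum_const, Finset.card_univ,
      hcardF, nsmul_eq_mul] at h1
  have htrP : algebraMap ℤ (𝓞 F) (Algebra.intTrace ℤ (𝓞 F) π) ∈ P := by
    have h1 : (ℓ : 𝓞 F) * π ∈ P := Ideal.mul_mem_left _ _ hπ1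
    have h2 := Ideal.add_mem _ ((Ideal.pow_le_self (by norm_num) : P ^ 2 ≤ P) htr) h1
    simpa using h2
  have htrP2 : algebraMap ℤ (𝓞 F) (Algebra.intTrace ℤ (𝓞 F) π) ∈ P ^ 2 :=
    hint2 _ ((hint _).mp htrP)
  have hℓπ : π * (ℓ : 𝓞 F) ∈ P ^ 2 := by
    rw [mul_comm]; simpa using Ideal.sub_mem _ htrP2 htr
  have hℓP : (ℓ : 𝓞 F) ∈ P := mem_prime_of_mul_mem_pow hPbot (i := 1) hπ2 (by simpa using hℓπ)
  have hpℓ : (p : ℤ) ∣ (ℓ : ℤ) := by rw [← hint]; simpa using hℓP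
  exact hcon.1 ((Nat.prime_dvd_prime_iff_eq hp hℓ).mp (by exact_mod_cast hpℓ))

/-- In a Galois number field the ramification index of a prime above `p` divides the degree. -/
theorem ramificationIdx_dvd_finrank {p : ℕ} (hp : p.Prime)
    (P : Ideal (𝓞 F)) [P.IsPrime] [P.LiesOver (span {(p : ℤ)})] :
    P.ramificationIdx ℤ ∣ Module.finrank ℚ F := by
  refine ⟨((span {(p : ℤ)}).primesOver (𝓞 F)).ncard * P.inertiaDeg ℤ, ?_⟩
  rw [← ncard_primesOver_mul_ramificationIdx_mul_inertiaDeg hp P]; ring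

/-- In a Galois number field of prime degree `ℓ`, a prime above `p` is either unramified
(`e = 1`) or totally ramified (`e = ℓ`). -/
theorem ramificationIdx_eq_one_or_eq_finrank (hℓ : (Module.finrank ℚ F).Prime) {p : ℕ}
    (hp : p.Prime) (P : Ideal (𝓞 F)) [P.IsPrime] [P.LiesOver (span {(p : ℤ)})] :
    P.ramificationIdx ℤ = 1 ∨ P.ramificationIdx ℤ = Module.finrank ℚ F :=
  hℓ.eq_one_or_self_of_dvd _ (ramificationIdx_dvd_finrank hp P)

/-- **Unramified primes in prime-degree Galois extensions of `ℚ`.**  If `[F : ℚ] = ℓ` is prime and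
`p` is a rational prime with `p ≠ ℓ` and `p ≢ 1 (mod ℓ)`, then every prime of `𝓞 F` above `p` is
unramified: `e(P ∣ p) = 1`. -/
theorem ramificationIdx_eq_one_of_ne_of_mod_ne_one (hℓ : (Module.finrank ℚ F).Prime) {p : ℕ}
    (hp : p.Prime) (h1 : p ≠ Module.finrank ℚ F) (h2 : p % Module.finrank ℚ F ≠ 1)
    (P : Ideal (𝓞 F)) [P.IsPrime] [P.LiesOver (span {(p : ℤ)})] :
    P.ramificationIdx ℤ = 1 := by
  rcases ramificationIdx_eq_one_or_eq_finrank hℓ hp P with h | h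
  · exact h
  · rcases eq_or_mod_eq_one_of_ramificationIdx_eq_finrank hℓ hp P h with h' | h'
    · exact absurd h' h1
    · exact absurd h' h2

/-- In a Galois number field of prime degree `ℓ`, an unramified rational prime `p` is either inert
(`f = ℓ`, one prime above `p`) or splits completely (`ℓ` primes above `p`, each of degree `1`). -/
theorem inert_or_splitsCompletely_of_ramificationIdx_eq_one (hℓ : (Module.finrank ℚ F).Prime)
    {p : ℕ} (hp : p.Prime) (P : Ideal (𝓞 F)) [P.IsPrime] [P.LiesOver (span {(p : ℤ)})]
    (he : P.ramificationIdx ℤ = 1) :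
    (P.inertiaDeg ℤ = Module.finrank ℚ F ∧ ((span {(p : ℤ)}).primesOver (𝓞 F)).ncard = 1) ∨
      (((span {(p : ℤ)}).primesOver (𝓞 F)).ncard = Module.finrank ℚ F ∧ P.inertiaDeg ℤ = 1) := by
  have h := ncard_primesOver_mul_ramificationIdx_mul_inertiaDeg hp P
  rw [he, one_mul] at h
  have h' := hℓ
  rw [← h, Nat.prime_mul_iff] at h'
  rcases h' with ⟨-, hf⟩ | ⟨-, hg⟩
  · right
    refine ⟨?_, hf⟩
    rw [← h, hf, mul_one]
  · left
    refine ⟨?_, hg⟩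
    rw [← h, hg, one_mul]

section cubic

variable (h3 : Module.finrank ℚ F = 3)
include h3

/-- **The prime `2` is unramified in every Galois cubic number field** (every cyclic cubic field):
`e(P ∣ 2) = 1` for every prime `P` of `𝓞 F` above `2`.  This is
`T5CubicRamification.ramificationIdx_two_eq_one` freed of its cyclotomic (Kronecker–Weber)
hypothesis. -/
theorem ramificationIdx_two_eq_one (P : Ideal (𝓞 F)) [P.IsPrime]
    [P.LiesOver (span {(2 : ℤ)})] : P.ramificationIdx ℤ = 1 := by
  have hP : P.LiesOver (span {((2 : ℕ) : ℤ)}) := by simpa using ‹P.LiesOver (span {(2 : ℤ)})›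
  have := ramificationIdx_eq_one_of_ne_of_mod_ne_one (p := 2) (by rw [h3]; norm_num) Nat.prime_two
    (by rw [h3]; norm_num) (by rw [h3]; norm_num) P
  exact this

/-- In a Galois cubic number field, `2` is inert (`f = 3`) or splits completely (`g = 3`). -/
theorem inert_or_splitsCompletely_two (P : Ideal (𝓞 F)) [P.IsPrime]
    [P.LiesOver (span {(2 : ℤ)})] :
    (P.inertiaDeg ℤ = 3 ∧ ((span {(2 : ℤ)}).primesOver (𝓞 F)).ncard = 1) ∨
      (((span {(2 : ℤ)}).primesOver (𝓞 F)).ncard = 3 ∧ P.inertiaDeg ℤ = 1) := by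
  have hP : P.LiesOver (span {((2 : ℕ) : ℤ)}) := by simpa using ‹P.LiesOver (span {(2 : ℤ)})›
  have := inert_or_splitsCompletely_of_ramificationIdx_eq_one (p := 2) (by rw [h3]; norm_num)
    Nat.prime_two P (ramificationIdx_two_eq_one h3 P)
  rw [h3] at this
  simpa using this

/-- **Ramified primes of a Galois cubic field are `3` or `≡ 1 (mod 3)`.**  This is
`T5CubicRamification.eq_three_or_mod_three_eq_one_of_ramified` freed of its cyclotomic hypothesis
(the «conductor–discriminant; Kronecker–Weber» sentence of §N2.8.2(b), ramification half). -/
theorem eq_three_or_mod_three_eq_one_of_ramified {p : ℕ} (hp : p.Prime) (P : Ideal (𝓞 F))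
    [P.IsPrime] [P.LiesOver (span {(p : ℤ)})] (he : P.ramificationIdx ℤ ≠ 1) :
    p = 3 ∨ p % 3 = 1 := by
  have hℓ : (Module.finrank ℚ F).Prime := by rw [h3]; norm_num
  rcases ramificationIdx_eq_one_or_eq_finrank hℓ hp P with h | h
  · exact absurd h he
  · have := eq_or_mod_eq_one_of_ramificationIdx_eq_finrank hℓ hp P h
    rwa [h3] at this

end cubic

end main

end Summit.Ventures.HodgeRepro2.T5TameCongruence
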